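/-
Copyright (c) 2026 the pub-hodgecm2 formalisation cell (harness21).  New file.
Origin: seat `prover-pub-hodgecm2-item6-p2-g10-0` (unit pub-hodgecm2-item6-p2, TRANSPOSITION item (vi) extra prover p2, gen 10),
2026-08-21 — TRANSPORT helpers for the (J3) PLACEMENT JUNCTION (`Transposition/Item6PlacementJunction.lean`, p305984): the T-side
printed-sentence binders `hnv`, `hmult` and the summand identification `ψ`/`hψ` of that file DISCHARGED ∕ BUILT from D-side records and
PER-SUMMAND identifications.  KERNEL only: theorems, no `def`, no cited record beyond the displayed binders; count-neutral; HC_CM is NOT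
proved; nothing here is a claim of the manuscripts under adjudication.
-/
import Summits.HodgeConjecture.CorCM.B01.Transposition.Item6PlacementJunction
import HarnessLib

set_option autoImplicit false

/-!
# (J3) transport: per-summand identifications ⟹ the junction's `ψ`, `hnv`, `hmult`

The junction `thm418Realised_of_asPrinted` (item6-p2, p305984) consumes, at one character `μ`, a `ℂ`-linear identification
`ψ : ⨁_a ω_T(μ,a) ≃ ⨁_i ω_D(i)` of the package record's `μ`-pieces with Liu's as-printed summands, `G`-equivariant (`hψ`), and the
rank-one branch `thm418Combined_of_realised_rankOne` consumes `hnv`/`hmult` ON THE RECORD `T`.  At an instance the natural data are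
PER-SUMMAND: an injective re-indexing `σ : T.Adm μ → D.AdmIndex` (row (S′)/(Ω-i) of the object match) and `ℂ`-linear equivariant
identifications `e a : T.Ω μ a ≃ₗ[ℂ] D.omegaAt (σ a)`; and the printed sentences live on Liu's side as RECORDS: `ω_D(i) ≠ 0`
(Def. 4.11 / App. D Lem. D.1 (1), tree `LemD1AsPrinted`) and multiplicity one `rank ℂ (ω_D(i).asModule →ₗ[ℂ[G]] H) ≤ 1`
(Prop. 4.13 proof l. 2145, tree `Prop413MultOneAsPrinted` through tr-prover-6's currency bridge in `Thm418BlockLeRange`).  This file: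

* `thm418Realised_of_asPrinted_map` — the junction's §2 with `ψ` an injective `ℂ`-linear MAP (not an equivalence);
* `exists_sumEmbedding` — from `(σ, hσ, e, he)` an injective equivariant `ψ : ⨁_a ω_T(μ,a) →ₗ[ℂ] ⨁_i ω_D(i)` (`ψ (ι_a m) = ι_{σ a} (e a m)`);
* `thm418Realised_of_asPrinted_summands` — §2 from per-summand data;
* `nontrivial_Ω_of_summand_equiv`, `rank_hom_le_one_of_summand_equiv` — `hnv`, `hmult` on `T` from the D-side records along `e`;
* `thm418Combined_of_realised_rankOne'` — the rank-one junction with its three hypotheses asked only at the `μ` with `τ' ∈ Φ_μ`.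

All `[folklore]` plumbing; the cited sentences are the consumer's records.  HC_CM is NOT proved; no pin is discharged here.
-/

noncomputable section

open scoped DirectSum TensorProduct

namespace HodgeCM.Literature.Theta

namespace LiuAlbaneseModuleDatum

open Literature.NumberTheory.Automorphic.Liu2021 NumberField

universe v w

variable {F E : Type} [Field F] [NumberField F] [IsTotallyReal F] [Field E] [NumberField E] [Algebra F E]
  [IsTotallyComplex E] [Algebra.IsQuadraticExtension F E]

/-! ## §1. The junction's §2 with `ψ` an injective linear map -/

/-- **«Thm. 4.18 realised at `μ`» from Thm. 4.18 AS PRINTED, map form**: as `thm418Realised_of_asPrinted` (p305984 §2) with the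
summand identification `ψ` an injective `G`-equivariant `ℂ`-linear MAP `⨁_a ω_T(μ,a) → ⨁_i ω_D(i)` instead of an equivalence (only
injectivity and equivariance of `ψ` enter: `g := J ∘ Φ⁻¹ ∘ ψ`). [cite: Liu2021, Thm. 4.18, Thm. 4.18 (1), (4.3)] -/
theorem thm418Realised_of_asPrinted_map (D : Thm418Data F E) {Lvl : Type v} [Preorder Lvl] {Kof : Lvl → Subgroup D.G}
    {T : LiuAlbaneseModuleDatum D.G Kof}
    {W : Lvl → Type w} [∀ K, AddCommGroup (W K)] [∀ K, Module ℂ (W K)]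
    {res : ∀ K : Lvl, T.H →ₗ[ℂ] W K} {cmCl : ∀ K : Lvl, T.Char → Set (W K)} {μ : T.Char}
    (hLiu : Thm418AsPrinted D)
    (hmono : ∀ ⦃K K' : Lvl⦄, K ≤ K' → Kof K ≤ Kof K') (hoc : ∀ K : Lvl, IsOpenCompact (Kof K))
    (hcof : ∀ K₀ : Subgroup D.G, IsOpenCompact K₀ → ∃ K₁ : Lvl, Kof K₁ ≤ K₀)
    (ψ : (⨁ a : T.Adm μ, T.Ω μ a) →ₗ[ℂ] ⨁ i : D.AdmIndex, D.omegaAt i) (hψinj : Function.Injective ψ)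
    (hψ : ∀ (g : D.G) (y : ⨁ a : T.Adm μ, T.Ω μ a) (i : D.AdmIndex),
      ψ (MonoidAlgebra.of ℂ D.G g • y) i = D.rhoAt i g (ψ y i))
    (J : ℂ ⊗[fieldOfValues E D.μ] D.Ω →ₗ[ℂ] T.H) (hJinj : Function.Injective J)
    (hJ : ∀ (g : D.G) (x : ℂ ⊗[fieldOfValues E D.μ] D.Ω),
      J ((D.rhoΩ g).baseChange ℂ x) = MonoidAlgebra.of ℂ D.G g • J x)
    (Dμ : D.Obj)
    (hpin : ∀ (K : Lvl) (φ : D.HomK (Kof K) Dμ),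
      res K (J ((1 : ℂ) ⊗ₜ[fieldOfValues E D.μ] D.res (Kof K) Dμ φ)) ∈ cmCl K μ) :
    ∃ g : (⨁ a : T.Adm μ, T.Ω μ a) →ₗ[MonoidAlgebra ℂ D.G] T.H, Function.Injective g ∧
      ∃ K₀ : Lvl, ∀ K ≤ K₀, ∀ y, g y ∈ fixedBy (Kof K) T.H → res K (g y) ∈ Submodule.span ℂ (cmCl K μ) := by
  obtain ⟨Φ, hΦ, -, -, -⟩ := id hLiu
  -- the `ℂ`-linear composite `g₀ := J ∘ Φ⁻¹ ∘ ψ`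
  let g₀ : (⨁ a : T.Adm μ, T.Ω μ a) →ₗ[ℂ] T.H := J ∘ₗ (Φ.symm.toLinearMap ∘ₗ ψ)
  have hg₀ : ∀ y, g₀ y = J (Φ.symm (ψ y)) := fun _ => rfl
  -- `Φ⁻¹ ∘ ψ` is `G`-equivariant
  have hsymm : ∀ (g : D.G) (y : ⨁ a : T.Adm μ, T.Ω μ a),
      (D.rhoΩ g).baseChange ℂ (Φ.symm (ψ y)) = Φ.symm (ψ (MonoidAlgebra.of ℂ D.G g • y)) := by
    intro g y
    apply Φ.injective
    rw [LinearEquiv.apply_symm_apply]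
    refine DFinsupp.ext fun i => ?_
    rw [hΦ, LinearEquiv.apply_symm_apply, hψ]
  have hcomm : ∀ (g : D.G) (y : ⨁ a : T.Adm μ, T.Ω μ a),
      g₀ (MonoidAlgebra.single g (1 : ℂ) • y) = MonoidAlgebra.single g (1 : ℂ) • g₀ y := by
    intro g y
    rw [← MonoidAlgebra.of_apply, hg₀, hg₀, ← hsymm, hJ]
  let g : (⨁ a : T.Adm μ, T.Ω μ a) →ₗ[MonoidAlgebra ℂ D.G] T.H := MonoidAlgebra.equivariantOfLinearOfComm g₀ hcomm
  have hg : ∀ y, g y = J (Φ.symm (ψ y)) := fun _ => rfl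
  obtain ⟨K₀, hK₀⟩ := Thm418Data.resW_mem_span_of_fixed_of_thm418AsPrinted_act hLiu Dμ Kof hmono hoc hcof
    (fun (g : D.G) (x : T.H) => MonoidAlgebra.of ℂ D.G g • x) res (fun K => cmCl K μ) J hJ hJinj hpin
  refine ⟨g, hJinj.comp (Φ.symm.injective.comp hψinj), K₀, fun K hKle y hfix => ?_⟩
  rw [hg]
  exact hK₀ K hKle (Φ.symm (ψ y)) fun k hk => by rw [← hg]; exact hfix k hk

/-! ## §2. The summand identification from per-summand data -/

/-- **The junction's `ψ` from per-summand identifications.**  An injective re-indexing `σ` of the record's `μ`-admissible indices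
into Liu's `(ε, χ)` and `G`-equivariant `ℂ`-linear identifications `e a : ω_T(μ,a) ≃ ω_D(σ a)` assemble to an injective `G`-equivariant
`ℂ`-linear `ψ : ⨁_a ω_T(μ,a) → ⨁_i ω_D(i)` with `ψ (ι_a m) = ι_{σ a} (e a m)`. [folklore] -/
theorem exists_sumEmbedding (D : Thm418Data F E) [DecidableEq D.AdmIndex] {Lvl : Type v} {Kof : Lvl → Subgroup D.G}
    (T : LiuAlbaneseModuleDatum D.G Kof) (μ : T.Char) [DecidableEq (T.Adm μ)]
    (σ : T.Adm μ → D.AdmIndex) (hσ : Function.Injective σ)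
    (e : ∀ a : T.Adm μ, T.Ω μ a ≃ₗ[ℂ] D.omegaAt (σ a))
    (he : ∀ (a : T.Adm μ) (g : D.G) (m : T.Ω μ a), e a (MonoidAlgebra.of ℂ D.G g • m) = D.rhoAt (σ a) g (e a m)) :
    ∃ ψ : (⨁ a : T.Adm μ, T.Ω μ a) →ₗ[ℂ] ⨁ i : D.AdmIndex, D.omegaAt i,
      Function.Injective ψ ∧
      (∀ (g : D.G) (y : ⨁ a : T.Adm μ, T.Ω μ a) (i : D.AdmIndex),
        ψ (MonoidAlgebra.of ℂ D.G g • y) i = D.rhoAt i g (ψ y i)) ∧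
      (∀ (a : T.Adm μ) (m : T.Ω μ a),
        ψ (DirectSum.lof ℂ (T.Adm μ) (fun a => T.Ω μ a) a m) = DirectSum.lof ℂ D.AdmIndex D.omegaAt (σ a) (e a m)) := by
  let ψ : (⨁ a : T.Adm μ, T.Ω μ a) →ₗ[ℂ] ⨁ i : D.AdmIndex, D.omegaAt i :=
    DirectSum.toModule ℂ (T.Adm μ) (⨁ i : D.AdmIndex, D.omegaAt i)
      fun a => DirectSum.lof ℂ D.AdmIndex D.omegaAt (σ a) ∘ₗ (e a).toLinearMap
  have hψlof : ∀ (a : T.Adm μ) (m : T.Ω μ a),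
      ψ (DirectSum.lof ℂ (T.Adm μ) (fun a => T.Ω μ a) a m) = DirectSum.lof ℂ D.AdmIndex D.omegaAt (σ a) (e a m) := by
    intro a m
    simp only [ψ, DirectSum.toModule_lof, LinearMap.coe_comp, LinearEquiv.coe_coe, Function.comp_apply]
  -- the `σ a`-component of `ψ y` is `e a (y a)`
  have hcomp : ∀ (y : ⨁ a : T.Adm μ, T.Ω μ a) (a : T.Adm μ), ψ y (σ a) = e a (y a) := by
    intro y a
    induction y using DirectSum.induction_on with
    | zero => simp only [map_zero, DirectSum.zero_apply]
    | of b m =>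
      rw [← DirectSum.lof_eq_of ℂ, hψlof, DirectSum.lof_eq_of, DirectSum.lof_eq_of]
      by_cases hba : b = a
      · subst hba
        rw [DirectSum.of_eq_same, DirectSum.of_eq_same]
      · rw [DirectSum.of_eq_of_ne _ _ _ (fun h => hba (hσ h).symm), DirectSum.of_eq_of_ne _ _ _ (Ne.symm hba), map_zero]
    | add y z hy hz => simp only [map_add, DirectSum.add_apply, hy, hz]
  refine ⟨ψ, fun y y' hyy' => ?_, fun g y i => ?_, hψlof⟩
  · refine DFinsupp.ext fun a => (e a).injective ?_
    rw [← hcomp, ← hcomp, hyy']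
  · induction y using DirectSum.induction_on with
    | zero => simp only [smul_zero, map_zero, DirectSum.zero_apply]
    | of a m =>
      -- `of g • ι_a m = ι_a (of g • m)`: the `ℂ[G]`-linear `lof` has the same underlying map as the `ℂ`-linear one
      have hsm : MonoidAlgebra.of ℂ D.G g • DirectSum.lof ℂ (T.Adm μ) (fun a => T.Ω μ a) a m =
          DirectSum.lof ℂ (T.Adm μ) (fun a => T.Ω μ a) a (MonoidAlgebra.of ℂ D.G g • m) :=
        ((DirectSum.lof (MonoidAlgebra ℂ D.G) (T.Adm μ) (fun a => T.Ω μ a) a).map_smul (MonoidAlgebra.of ℂ D.G g) m).symm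
      rw [← DirectSum.lof_eq_of ℂ, hsm, hψlof, hψlof, he, DirectSum.lof_eq_of, DirectSum.lof_eq_of]
      by_cases hi : i = σ a
      · subst hi
        rw [DirectSum.of_eq_same, DirectSum.of_eq_same]
      · rw [DirectSum.of_eq_of_ne _ _ _ hi, DirectSum.of_eq_of_ne _ _ _ hi, map_zero]
    | add y z hy hz => simp only [smul_add, map_add, DirectSum.add_apply, hy, hz]

/-- **«Thm. 4.18 realised at `μ`» from Thm. 4.18 AS PRINTED and PER-SUMMAND identifications** (`σ` injective re-indexing, `e a`
equivariant `ℂ`-linear identifications `ω_T(μ,a) ≃ ω_D(σ a)`), the (4.3)-carrier `J` and the class pin `hpin`.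
[cite: Liu2021, Thm. 4.18, Thm. 4.18 (1), (4.3)] -/
theorem thm418Realised_of_asPrinted_summands (D : Thm418Data F E) {Lvl : Type v} [Preorder Lvl] {Kof : Lvl → Subgroup D.G}
    {T : LiuAlbaneseModuleDatum D.G Kof}
    {W : Lvl → Type w} [∀ K, AddCommGroup (W K)] [∀ K, Module ℂ (W K)]
    {res : ∀ K : Lvl, T.H →ₗ[ℂ] W K} {cmCl : ∀ K : Lvl, T.Char → Set (W K)} {μ : T.Char}
    (hLiu : Thm418AsPrinted D)
    (hmono : ∀ ⦃K K' : Lvl⦄, K ≤ K' → Kof K ≤ Kof K') (hoc : ∀ K : Lvl, IsOpenCompact (Kof K))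
    (hcof : ∀ K₀ : Subgroup D.G, IsOpenCompact K₀ → ∃ K₁ : Lvl, Kof K₁ ≤ K₀)
    (σ : T.Adm μ → D.AdmIndex) (hσ : Function.Injective σ)
    (e : ∀ a : T.Adm μ, T.Ω μ a ≃ₗ[ℂ] D.omegaAt (σ a))
    (he : ∀ (a : T.Adm μ) (g : D.G) (m : T.Ω μ a), e a (MonoidAlgebra.of ℂ D.G g • m) = D.rhoAt (σ a) g (e a m))
    (J : ℂ ⊗[fieldOfValues E D.μ] D.Ω →ₗ[ℂ] T.H) (hJinj : Function.Injective J)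
    (hJ : ∀ (g : D.G) (x : ℂ ⊗[fieldOfValues E D.μ] D.Ω),
      J ((D.rhoΩ g).baseChange ℂ x) = MonoidAlgebra.of ℂ D.G g • J x)
    (Dμ : D.Obj)
    (hpin : ∀ (K : Lvl) (φ : D.HomK (Kof K) Dμ),
      res K (J ((1 : ℂ) ⊗ₜ[fieldOfValues E D.μ] D.res (Kof K) Dμ φ)) ∈ cmCl K μ) :
    ∃ g : (⨁ a : T.Adm μ, T.Ω μ a) →ₗ[MonoidAlgebra ℂ D.G] T.H, Function.Injective g ∧
      ∃ K₀ : Lvl, ∀ K ≤ K₀, ∀ y, g y ∈ fixedBy (Kof K) T.H → res K (g y) ∈ Submodule.span ℂ (cmCl K μ) := by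
  classical
  obtain ⟨ψ, hψinj, hψ, -⟩ := exists_sumEmbedding D T μ σ hσ e he
  exact thm418Realised_of_asPrinted_map D hLiu hmono hoc hcof ψ hψinj hψ J hJinj hJ Dμ hpin

/-! ## §3. `hnv` and `hmult` on the record from the D-side records -/

/-- `ω_T(μ,a) ≠ 0` from `ω_D(σ a) ≠ 0` [Def. 4.11 / App. D Lem. D.1 (1), record side] along the identification. [folklore] -/
theorem nontrivial_Ω_of_summand_equiv (D : Thm418Data F E) {Lvl : Type v} {Kof : Lvl → Subgroup D.G}
    (T : LiuAlbaneseModuleDatum D.G Kof) {μ : T.Char} (σ : T.Adm μ → D.AdmIndex)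
    (e : ∀ a : T.Adm μ, T.Ω μ a ≃ₗ[ℂ] D.omegaAt (σ a))
    (hnvD : ∀ i : D.AdmIndex, Nontrivial (D.omegaAt i)) (a : T.Adm μ) : Nontrivial (T.Ω μ a) :=
  haveI := hnvD (σ a)
  (e a).toEquiv.nontrivial

/-- **Multiplicity one on the record from the D-side record.**  From `rank ℂ (ω_D(i).asModule →ₗ[ℂ[G]] H) ≤ 1` for all `i`
([Liu2021] proof of Prop. 4.13, l. 2145 — record `Prop413Data.MultOneAsPrinted` read through
`Thm418Data.rank_linearMap_asModule_le_rank_intertwiningMap_ofModule'`) and equivariant `ℂ`-linear identifications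
`e a : ω_T(μ,a) ≃ ω_D(σ a)`: `rank ℂ (ω_T(μ,a) →ₗ[ℂ[G]] H) ≤ 1`.  KERNEL: `e a` upgrades to a `ℂ[G]`-linear equivalence onto
`(D.rhoAt (σ a)).asModule` (`MonoidAlgebra.equivariantOfLinearOfComm` after `asModuleEquiv`), then `rank_hom_le_one_of_equiv`.
[cite: Liu2021, Prop. 4.13, proof l. 2145] -/
theorem rank_hom_le_one_of_summand_equiv (D : Thm418Data F E) {Lvl : Type v} {Kof : Lvl → Subgroup D.G}
    (T : LiuAlbaneseModuleDatum D.G Kof) {μ : T.Char} (σ : T.Adm μ → D.AdmIndex)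
    (e : ∀ a : T.Adm μ, T.Ω μ a ≃ₗ[ℂ] D.omegaAt (σ a))
    (he : ∀ (a : T.Adm μ) (g : D.G) (m : T.Ω μ a), e a (MonoidAlgebra.of ℂ D.G g • m) = D.rhoAt (σ a) g (e a m))
    (hmultD : ∀ i : D.AdmIndex, Module.rank ℂ ((D.rhoAt i).asModule →ₗ[MonoidAlgebra ℂ D.G] T.H) ≤ 1)
    (a : T.Adm μ) : Module.rank ℂ (T.Ω μ a →ₗ[MonoidAlgebra ℂ D.G] T.H) ≤ 1 := by
  -- upgrade each `e b` to a `ℂ[G]`-linear equivalence onto `(D.rhoAt (σ b)).asModule`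
  have hE : ∀ b : T.Adm μ, Nonempty (T.Ω μ b ≃ₗ[MonoidAlgebra ℂ D.G] (D.rhoAt (σ b)).asModule) := by
    intro b
    let f : T.Ω μ b →ₗ[ℂ] (D.rhoAt (σ b)).asModule :=
      (D.rhoAt (σ b)).asModuleEquiv.symm.toLinearMap ∘ₗ (e b).toLinearMap
    have hf : ∀ m, f m = (D.rhoAt (σ b)).asModuleEquiv.symm (e b m) := fun _ => rfl
    have hcomm : ∀ (g : D.G) (m : T.Ω μ b),
        f (MonoidAlgebra.single g (1 : ℂ) • m) = MonoidAlgebra.single g (1 : ℂ) • f m := by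
      intro g m
      rw [hf, hf, ← MonoidAlgebra.of_apply, he, Representation.asModuleEquiv_symm_map_rho]
    have hbij : Function.Bijective (MonoidAlgebra.equivariantOfLinearOfComm f hcomm) := by
      change Function.Bijective f
      exact (D.rhoAt (σ b)).asModuleEquiv.symm.bijective.comp (e b).bijective
    exact ⟨LinearEquiv.ofBijective _ hbij⟩
  exact rank_hom_le_one_of_equiv (T := T) (M := fun i : D.AdmIndex => (D.rhoAt i).asModule) σ
    (fun b => (hE b).some) hmultD a

/-! ## §4. The rank-one junction with hypotheses only at the characters with `τ' ∈ Φ_μ` -/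

/-- **THE PLACEMENT JUNCTION, rank-one branch, per-`μ` form**: as `thm418Combined_of_realised_rankOne` (p305984 :159) but with
`hnv`, `hmult`, `hreal` asked only at the characters `μ` with `τ' ∈ Φ_μ` — the ones the combined reading r8 quantifies over — so that an
instance may discharge them per `μ` from the as-printed records (`thm418Realised_of_asPrinted_summands`,
`nontrivial_Ω_of_summand_equiv`, `rank_hom_le_one_of_summand_equiv`). [cite: Liu2021, Prop. 4.13, proof l. 2145; Def. 4.11; Thm. 4.18, Thm. 4.18 (1), (4.3)] -/
theorem thm418Combined_of_realised_rankOne' {G : Type} [Group G] {Lvl : Type v} [Preorder Lvl] {Kof : Lvl → Subgroup G}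
    {T : LiuAlbaneseModuleDatum G Kof} {W : Lvl → Type w} [∀ K, AddCommGroup (W K)] [∀ K, Module ℂ (W K)]
    {res : ∀ K : Lvl, T.H →ₗ[ℂ] W K} {cmCl : ∀ K : Lvl, T.Char → Set (W K)}
    (h : ∀ μ : T.Char, T.PhiMu μ →
      (∀ a : T.Adm μ, Nontrivial (T.Ω μ a)) ∧
      (∀ a : T.Adm μ, Module.rank ℂ (T.Ω μ a →ₗ[MonoidAlgebra ℂ G] T.H) ≤ 1) ∧
      (∃ g : (⨁ a : T.Adm μ, T.Ω μ a) →ₗ[MonoidAlgebra ℂ G] T.H, Function.Injective g ∧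
        ∃ K₀ : Lvl, ∀ K ≤ K₀, ∀ y, g y ∈ fixedBy (Kof K) T.H → res K (g y) ∈ Submodule.span ℂ (cmCl K μ))) :
    T.Thm418Combined res cmCl := by
  intro μ hΦ
  obtain ⟨hnv, hmult, g, hg, K₀, hK⟩ := h μ hΦ
  refine ⟨K₀, fun K hKle x hx hfix => ?_⟩
  obtain ⟨y, rfl⟩ : x ∈ (LinearMap.range g).restrictScalars ℂ := block_le_range_of_rank_hom_le_one hnv hmult hg hx
  exact hK K hKle y hfix

/-- **THE PLACEMENT JUNCTION from the as-printed records and per-summand identifications** (one `μ`; the instance assembles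
over `μ` with `thm418Combined_of_realised_rankOne'`): at a character `μ` of the record `T` over Liu's group `D.G`, Thm. 4.18 AS
PRINTED for `D` + the per-summand identification `(σ, e)` + the (4.3)-carrier `J` + the class pin `hpin` + the D-side records
`ω_D(i) ≠ 0` and multiplicity one give ALL THREE inputs of the rank-one junction at `μ`. [cite: Liu2021, Thm. 4.18, Thm. 4.18 (1), (4.3); Prop. 4.13, proof l. 2145; Def. 4.11] -/
theorem rankOne_inputs_of_asPrinted_summands (D : Thm418Data F E) {Lvl : Type v} [Preorder Lvl] {Kof : Lvl → Subgroup D.G}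
    {T : LiuAlbaneseModuleDatum D.G Kof}
    {W : Lvl → Type w} [∀ K, AddCommGroup (W K)] [∀ K, Module ℂ (W K)]
    {res : ∀ K : Lvl, T.H →ₗ[ℂ] W K} {cmCl : ∀ K : Lvl, T.Char → Set (W K)} {μ : T.Char}
    (hLiu : Thm418AsPrinted D)
    (hmono : ∀ ⦃K K' : Lvl⦄, K ≤ K' → Kof K ≤ Kof K') (hoc : ∀ K : Lvl, IsOpenCompact (Kof K))
    (hcof : ∀ K₀ : Subgroup D.G, IsOpenCompact K₀ → ∃ K₁ : Lvl, Kof K₁ ≤ K₀)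
    (σ : T.Adm μ → D.AdmIndex) (hσ : Function.Injective σ)
    (e : ∀ a : T.Adm μ, T.Ω μ a ≃ₗ[ℂ] D.omegaAt (σ a))
    (he : ∀ (a : T.Adm μ) (g : D.G) (m : T.Ω μ a), e a (MonoidAlgebra.of ℂ D.G g • m) = D.rhoAt (σ a) g (e a m))
    (J : ℂ ⊗[fieldOfValues E D.μ] D.Ω →ₗ[ℂ] T.H) (hJinj : Function.Injective J)
    (hJ : ∀ (g : D.G) (x : ℂ ⊗[fieldOfValues E D.μ] D.Ω),
      J ((D.rhoΩ g).baseChange ℂ x) = MonoidAlgebra.of ℂ D.G g • J x)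
    (Dμ : D.Obj)
    (hpin : ∀ (K : Lvl) (φ : D.HomK (Kof K) Dμ),
      res K (J ((1 : ℂ) ⊗ₜ[fieldOfValues E D.μ] D.res (Kof K) Dμ φ)) ∈ cmCl K μ)
    (hnvD : ∀ i : D.AdmIndex, Nontrivial (D.omegaAt i))
    (hmultD : ∀ i : D.AdmIndex, Module.rank ℂ ((D.rhoAt i).asModule →ₗ[MonoidAlgebra ℂ D.G] T.H) ≤ 1) :
    (∀ a : T.Adm μ, Nontrivial (T.Ω μ a)) ∧
      (∀ a : T.Adm μ, Module.rank ℂ (T.Ω μ a →ₗ[MonoidAlgebra ℂ D.G] T.H) ≤ 1) ∧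
      (∃ g : (⨁ a : T.Adm μ, T.Ω μ a) →ₗ[MonoidAlgebra ℂ D.G] T.H, Function.Injective g ∧
        ∃ K₀ : Lvl, ∀ K ≤ K₀, ∀ y, g y ∈ fixedBy (Kof K) T.H → res K (g y) ∈ Submodule.span ℂ (cmCl K μ)) :=
  ⟨nontrivial_Ω_of_summand_equiv D T σ e hnvD, rank_hom_le_one_of_summand_equiv D T σ e he hmultD,
    thm418Realised_of_asPrinted_summands D hLiu hmono hoc hcof σ hσ e he J hJinj hJ Dμ hpin⟩

end LiuAlbaneseModuleDatum

end HodgeCM.Literature.Theta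

end
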